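import Summits.ABC.ABC.Theses.DefiniteXi
import HarnessLib

/-!
# Stub-ideation k2, generation 8 (FAMILY 2 — RESHAPE) — `stub_primeToSixDegreeBound` (P6)
# crux `DefiniteXi.SteinbergCore` (stmt-ABC-15024), line `p6_tamagawa_split`

Gens 2–7 of this seat (`…StubIdeas2G2/G3/G4/G5/G6`, gen 7 = prose only) stand by reference.  Gen 8
types ONE more cell of the weakening lattice of P6 — the last untyped one — and re-certifies the only
implication INTO the stub by name:

* `FixedPrimeDepthBound ℓ` — P6 restricted to ONE congruence prime `ℓ ∤ 6`, WITH multiplicity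
  (`ℓ^{v_ℓ(deg D)} ≤ C_ε N^{2+ε}` for minimal Frey data).  Lattice of weakenings now typed:
  support only (`StubIdeas2G6.FreyCpsPrimeBound`, sup over primes) · fixed prime with depth (THIS) ·
  bounded `ω(N)` (`IneffectiveSubspace.UniformSadicTowerFour`) · polynomial exponent
  (`DefiniteXi.PolyFreyDegree`) · Baker-class log rung (`StubIdeas3G4.LogRung`, proved mod
  `MinimalDegUpper 1`).  For `ℓ ≥ 5` and Frey curves (`ℓ² ∤ N_odd`), `v_ℓ(deg_min) = v_ℓ(r_E)` =
  length of the level-`N` adjoint Selmer group of `ρ_{E,ℓ}` (Agashe–Ribet–Stein Thm 2.2; Wiles /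
  Diamond numerical criterion), so the cell is "one adjoint Selmer length is `O_ε(log N)`": its only
  upper bounds are the Bloch–Kato identity (= the degree itself) and the Sturm/Murty resultant bound
  `v_ℓ(η_f) log ℓ ≤ Σ_g d_g log(4√p_g) ≍ N log N` — the same wall as P6.  No tool; documentation cell.
* `fixedPrimeDepthBound_of_stub` — PROVED: `Stub → FixedPrimeDepthBound ℓ` (`ℓ^{v_ℓ n} ∣ cps n`).
* The only implication INTO the stub is the TREE lemma
  `Summit.ABC.ABC.Theorems.SteinbergCorePrimeRung.primeToSixDegreeBound_of_freyDegreeBound :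
  FreyDegreeBound → Stub` (p162616, Theorems/DefiniteXiSteinbergCorePrimeRung.lean:236; not imported
  here only because the farm snapshot of that module's import closure was stale at check time).
-/

noncomputable section

set_option linter.dupNamespace false

namespace Summit.ABC.ABC.Cruxes.SteinbergCore.StubIdeas2G8

open Literature.NumberTheory.EllipticCurves Literature.NumberTheory.EllipticCurves.ModularForms
open Summit.ABC.ABC.Theses.DefiniteXi

/-- The registered stub, verbatim. [folklore] -/
def Stub : Prop :=
  ∀ ε : ℝ, 0 < ε → ∃ C : ℝ, ∀ a b : ℤ, IsCoprime a b → a * b * (a + b) ≠ 0 → ∀ (N : ℕ) [NeZero N],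
    (freyCurve a b).conductorNorm ℤ = N →
    ∀ D : ModularParametrizationData (freyCurve a b) N,
      (∀ D' : ModularParametrizationData (freyCurve a b) N, D.deg ≤ D'.deg) →
      ((D.deg / (ordProj[2] D.deg * ordProj[3] D.deg) : ℕ) : ℝ) ≤ C * (N : ℝ) ^ (2 + ε)

/-- **FixedPrimeDepthBound ℓ** — P6 for ONE congruence prime, with multiplicity: the `ℓ`-primary
part `ℓ^{v_ℓ(deg D)}` of the degree of a MINIMAL Frey datum is `≤ C_ε N^{2+ε}`.  For `ℓ ≥ 5` this is
the statement "the level-`N` adjoint Selmer length of `ρ_{E_(a,b),ℓ}` is `≤ (2+ε) log_ℓ N + O_ε(1)`"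
(ARS Thm 2.2 + numerical criterion).  Weaker than P6 (`fixedPrimeDepthBound_of_stub`); no converse;
no known tool (Bloch–Kato identity / Sturm–Murty wall). [folklore] -/
def FixedPrimeDepthBound (ℓ : ℕ) : Prop :=
  ∀ ε : ℝ, 0 < ε → ∃ C : ℝ, ∀ a b : ℤ, IsCoprime a b → a * b * (a + b) ≠ 0 → ∀ (N : ℕ) [NeZero N],
    (freyCurve a b).conductorNorm ℤ = N →
    ∀ D : ModularParametrizationData (freyCurve a b) N,
      (∀ D' : ModularParametrizationData (freyCurve a b) N, D.deg ≤ D'.deg) →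
      ((ordProj[ℓ] D.deg : ℕ) : ℝ) ≤ C * (N : ℝ) ^ (2 + ε)

/-- The 6-part `2^{v₂ n} · 3^{v₃ n}` divides `n`. [folklore] -/
theorem sixPart_dvd (n : ℕ) : ordProj[2] n * ordProj[3] n ∣ n := by
  have h2 : ordProj[2] n ∣ n := Nat.ordProj_dvd n 2
  have h3 : ordProj[3] n ∣ n := Nat.ordProj_dvd n 3
  have hcop : Nat.Coprime (ordProj[2] n) (ordProj[3] n) :=
    Nat.Coprime.pow _ _ (by norm_num)
  exact Nat.Coprime.mul_dvd_of_dvd_of_dvd hcop h2 h3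

/-- For a prime `ℓ ≠ 2, 3`, the `ℓ`-primary part of `n` divides the prime-to-6 part of `n`. [folklore] -/
theorem ordProj_dvd_primeToSix {ℓ : ℕ} (n : ℕ) (hℓ : ℓ.Prime) (h2 : ℓ ≠ 2) (h3 : ℓ ≠ 3) :
    ordProj[ℓ] n ∣ n / (ordProj[2] n * ordProj[3] n) := by
  have hs : ordProj[2] n * ordProj[3] n ∣ n := sixPart_dvd n
  have hc2 : Nat.Coprime ℓ 2 := (Nat.coprime_primes hℓ Nat.prime_two).mpr h2
  have hc3 : Nat.Coprime ℓ 3 := (Nat.coprime_primes hℓ Nat.prime_three).mpr h3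
  have hcop : Nat.Coprime (ordProj[ℓ] n) (ordProj[2] n * ordProj[3] n) :=
    Nat.Coprime.mul_right ((hc2.pow_right _).pow_left _) ((hc3.pow_right _).pow_left _)
  have h' : ordProj[ℓ] n ∣ n / (ordProj[2] n * ordProj[3] n) * (ordProj[2] n * ordProj[3] n) := by
    rw [Nat.div_mul_cancel hs]
    exact Nat.ordProj_dvd n ℓ
  exact hcop.dvd_of_dvd_mul_right h'

/-- **Calibration (PROVED): P6 gives every fixed-prime depth bound** (`ℓ^{v_ℓ n} ∣ cps n`, `cps n ≥ 1`). [folklore] -/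
theorem fixedPrimeDepthBound_of_stub (h : Stub) {ℓ : ℕ} (hℓ : ℓ.Prime) (h2 : ℓ ≠ 2) (h3 : ℓ ≠ 3) :
    FixedPrimeDepthBound ℓ := by
  intro ε hε
  obtain ⟨C, hC⟩ := h ε hε
  refine ⟨C, fun a b hab h0 N _ hN D hmin => ?_⟩
  have key : ordProj[ℓ] D.deg ∣ D.deg / (ordProj[2] D.deg * ordProj[3] D.deg) :=
    ordProj_dvd_primeToSix D.deg hℓ h2 h3
  have hpos : 0 < D.deg / (ordProj[2] D.deg * ordProj[3] D.deg) :=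
    Nat.div_pos (Nat.le_of_dvd D.deg_pos (sixPart_dvd D.deg)) (by positivity)
  have hle : ordProj[ℓ] D.deg ≤ D.deg / (ordProj[2] D.deg * ordProj[3] D.deg) := Nat.le_of_dvd hpos key
  calc ((ordProj[ℓ] D.deg : ℕ) : ℝ) ≤ ((D.deg / (ordProj[2] D.deg * ordProj[3] D.deg) : ℕ) : ℝ) := by
        exact_mod_cast hle
    _ ≤ C * (N : ℝ) ^ (2 + ε) := hC a b hab h0 N hN D hmin

end Summit.ABC.ABC.Cruxes.SteinbergCore.StubIdeas2G8

end
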